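import Literature.AlgebraicGeometry.Resolution.AffineBlowup
import Literature.AlgebraicGeometry.Resolution.IdealSheafLemmas
import Literature.AlgebraicGeometry.Resolution.Blowups
import HarnessLib

/-!
# The exceptional divisor of the affine blowing up is an effective Cartier divisor

Topic: `Literature/AlgebraicGeometry/Resolution`. Half of the universal property of blowing
ups (Stacks 0806; `IsBlowup` of `Blowups.lean`) for the CONSTRUCTED affine blowing up `Bl_I(Spec R) → Spec R`
(`AffineBlowup.lean`): the inverse image ideal sheaf of `I` on `Bl_I(Spec R)` — the ideal of the
exceptional divisor `π⁻¹(V(I))` — is effective Cartier (Stacks 02OS = Lemma 31.33.4 (2): "the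
exceptional divisor `E = b⁻¹(Z)` is an effective Cartier divisor on `X'`"), PROVED:

* (the general lemmas `comap_ofIdealTop_of_isAffine` etc. live in `IdealSheafLemmas.lean`);
* `affineBlowup.idealSheaf I` — the ideal sheaf of `I` on `Spec R`;
  `affineBlowup.exceptionalIdeal I := (idealSheaf I).comap (π I)`;
* `affineBlowup.exists_nonZeroDivisor_exceptionalIdeal`,
  `affineBlowup.isEffectiveCartier_exceptionalIdeal` — **the exceptional ideal is effective
  Cartier** (`IsEffectiveCartier`, `Blowups.lean`): on the chart
  `D₊(bt) ≅ Spec (R[It])_{(bt)}` it is generated by the nonzerodivisor `b/1`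
  (`span_image_reesChartBase_eq`, `reesChartBase_mem_nonZeroDivisors`), and the charts cover
  (`affineBlowup.iSup_basicOpen_reesT_eq_top`).

## Sources

* The Stacks Project, Tag 02OS (Lemma 31.33.4 (2)), Tag 0804 (Lemma 31.33.2). [StacksProject]
-/

noncomputable section

open CategoryTheory CategoryTheory.Limits AlgebraicGeometry TopologicalSpace Opposite
  HomogeneousLocalization

namespace Literature.AlgebraicGeometry.Resolution

universe u

/-! ## The exceptional ideal of the affine blowing up -/

variable {R : Type u} [CommRing R] (I : Ideal R)

/-- The ideal sheaf of `I ⊆ R` on `Spec R`. [folklore] -/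
def affineBlowup.idealSheaf : (Spec (.of R)).IdealSheafData :=
  Scheme.IdealSheafData.ofIdealTop (I.map (Scheme.ΓSpecIso (.of R)).inv.hom)

/-- The **exceptional ideal** of the affine blowing up: the inverse image ideal sheaf of `I`
on `Bl_I(Spec R)`, the ideal of the exceptional divisor `π⁻¹(V(I))`.
[cite: StacksProject, Tag 01OG] -/
def affineBlowup.exceptionalIdeal : (affineBlowup I).IdealSheafData :=
  (affineBlowup.idealSheaf I).comap (affineBlowup.π I)

variable {I}

/-- The chart `Spec (R[It])_{(bt)} → Bl_I(Spec R)` of `b ∈ I` (Mathlib `Proj.awayι`).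
[cite: StacksProject, Tag 0804] -/
def affineBlowup.chartι (b : R) (hb : b ∈ I) :
    Spec (.of (Away (reesGrading I) (reesT b hb))) ⟶ affineBlowup I :=
  Proj.awayι (reesGrading I) (reesT b hb) (reesT_mem b hb) one_pos

/-- The chart is an open immersion. [folklore] -/
instance affineBlowup.chartι_isOpenImmersion (b : R) (hb : b ∈ I) :
    IsOpenImmersion (affineBlowup.chartι (I := I) b hb) := by
  unfold affineBlowup.chartι; infer_instance

/-- The range of the chart is `D₊(bt)`. [folklore] -/
theorem affineBlowup.image_top_chartι (b : R) (hb : b ∈ I) :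
    affineBlowup.chartι (I := I) b hb ''ᵁ ⊤ = Proj.basicOpen (reesGrading I) (reesT b hb) := by
  rw [Scheme.Hom.image_top_eq_opensRange]
  exact Proj.opensRange_awayι _ _ _ _

/-- The chart `D₊(bt)` as an affine open of the blowing up. [folklore] -/
def affineBlowup.chartOpen (b : R) (hb : b ∈ I) : (affineBlowup I).affineOpens :=
  ⟨affineBlowup.chartι (I := I) b hb ''ᵁ ⊤, (isAffineOpen_top _).image_of_isOpenImmersion _⟩

/-- The chart morphism followed by `π` is `Spec` of `φ_b : R → (R[It])_{(bt)}`. [folklore] -/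
theorem affineBlowup.chartι_π (b : R) (hb : b ∈ I) :
    affineBlowup.chartι (I := I) b hb ≫ affineBlowup.π I =
      Spec.map (CommRingCat.ofHom (reesChartBase b hb)) := by
  rw [affineBlowup.chartι, affineBlowup.π, Proj.awayι_toSpecZero_assoc, ← Spec.map_comp]
  rfl

/-- The exceptional ideal pulled back to the chart `Spec (R[It])_{(bt)}` is the ideal sheaf of
`I · (R[It])_{(bt)}`. [folklore] -/
theorem affineBlowup.exceptionalIdeal_comap_chartι (b : R) (hb : b ∈ I) :
    (affineBlowup.exceptionalIdeal I).comap (affineBlowup.chartι b hb) =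
      Scheme.IdealSheafData.ofIdealTop ((I.map (reesChartBase b hb)).map
        (Scheme.ΓSpecIso (.of (Away (reesGrading I) (reesT b hb)))).inv.hom) := by
  rw [affineBlowup.exceptionalIdeal, ← Scheme.IdealSheafData.comap_comp, affineBlowup.chartι_π,
    affineBlowup.idealSheaf]
  exact comap_ofIdealTop_SpecMap (reesChartBase b hb) I

/-- `I · (R[It])_{(bt)}` is generated by `b/1`. [folklore] -/
theorem map_reesChartBase_eq (b : R) (hb : b ∈ I) :
    I.map (reesChartBase b hb) = Ideal.span {reesChartBase b hb b} :=
  span_image_reesChartBase_eq b hb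

/-- **On the chart `D₊(bt)` the exceptional ideal is generated by a nonzerodivisor.**
[cite: StacksProject, Tag 02OS] -/
theorem affineBlowup.exceptionalIdeal_chartOpen (b : R) (hb : b ∈ I) :
    ∃ g : Γ(affineBlowup I, affineBlowup.chartOpen (I := I) b hb),
      g ∈ nonZeroDivisors Γ(affineBlowup I, affineBlowup.chartOpen (I := I) b hb) ∧
      (affineBlowup.exceptionalIdeal I).ideal (affineBlowup.chartOpen b hb) = Ideal.span {g} := by
  -- notation
  let B := Away (reesGrading I) (reesT b hb)
  let j := affineBlowup.chartι (I := I) b hb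
  let K := affineBlowup.exceptionalIdeal I
  let ε : Γ(Spec (.of B), ⊤) ≅ CommRingCat.of B := Scheme.ΓSpecIso (.of B)
  -- the generator downstairs and its transport to `Γ(Spec B, ⊤)`
  have hφ : reesChartBase b hb b ∈ nonZeroDivisors B := reesChartBase_mem_nonZeroDivisors b hb
  let g₀ : Γ(Spec (.of B), ⊤) := ε.inv.hom (reesChartBase b hb b)
  have hg₀ : g₀ ∈ nonZeroDivisors _ :=
    mem_nonZeroDivisors_of_inverse ε.inv.hom ε.hom.hom (fun a => by
      change (ε.inv ≫ ε.hom).hom a = a; rw [ε.inv_hom_id]; rfl) (fun a => by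
      change (ε.hom ≫ ε.inv).hom a = a; rw [ε.hom_inv_id]; rfl) hφ
  -- the top ideal of the pulled-back exceptional ideal
  have h2 : (K.comap j).ideal ⟨⊤, isAffineOpen_top _⟩ = Ideal.span {g₀} := by
    rw [affineBlowup.exceptionalIdeal_comap_chartι, ideal_ofIdealTop_top, map_reesChartBase_eq,
      Ideal.map_span, Set.image_singleton]
  -- and upstairs through `Γ(Bl, j '' ⊤) ≅ Γ(Spec B, ⊤)`
  let e : Γ(affineBlowup I, affineBlowup.chartOpen (I := I) b hb) ≃+* Γ(Spec (.of B), ⊤) :=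
    (j.appIso ⊤).commRingCatIsoToRingEquiv
  have h3 : ((K.ideal (affineBlowup.chartOpen b hb)).comap e.symm.toRingHom) = Ideal.span {g₀} := by
    rw [← h2]
    exact (Scheme.IdealSheafData.ideal_comap_of_isOpenImmersion K j ⟨⊤, isAffineOpen_top _⟩).symm
  refine ⟨e.symm g₀, ?_, ?_⟩
  · exact mem_nonZeroDivisors_of_inverse e.symm.toRingHom e.toRingHom
      (fun a => e.apply_symm_apply a) (fun a => e.symm_apply_apply a) hg₀
  · have : K.ideal (affineBlowup.chartOpen b hb) =
        ((K.ideal (affineBlowup.chartOpen b hb)).comap e.symm.toRingHom).comap e.toRingHom := by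
      rw [Ideal.comap_comap]
      convert (Ideal.comap_id _).symm
      ext a
      exact e.symm_apply_apply a
    rw [this, h3]
    exact comap_span_singleton_ringEquiv e g₀

/-- **The exceptional ideal of the affine blowing up is effective Cartier** (Stacks 02OS =
Lemma 31.33.4 (2), for `Bl_I(Spec R)`), in unfolded form (literally
`IsEffectiveCartier (affineBlowup.exceptionalIdeal I)` of `Blowups.lean`): every point has an
affine open neighbourhood — a chart `D₊(bt)`, `b ∈ I` (`affineBlowup.iSup_basicOpen_reesT_eq_top`)
— on which the exceptional ideal is generated by one nonzerodivisor (`b/1`).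
[cite: StacksProject, Tag 02OS] -/
theorem affineBlowup.exists_nonZeroDivisor_exceptionalIdeal (x : affineBlowup I) :
    ∃ U : (affineBlowup I).affineOpens, x ∈ (U : (affineBlowup I).Opens) ∧
      ∃ g : Γ(affineBlowup I, U), g ∈ nonZeroDivisors Γ(affineBlowup I, U) ∧
        (affineBlowup.exceptionalIdeal I).ideal U = Ideal.span {g} := by
  have hx : x ∈ (⨆ b : I, Proj.basicOpen (reesGrading I) (reesT (I := I) b.1 b.2)) := by
    rw [affineBlowup.iSup_basicOpen_reesT_eq_top]; trivial
  obtain ⟨b, hb⟩ := Opens.mem_iSup.mp hx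
  obtain ⟨g, hg, hK⟩ := affineBlowup.exceptionalIdeal_chartOpen (I := I) b.1 b.2
  refine ⟨affineBlowup.chartOpen b.1 b.2, ?_, g, hg, hK⟩
  change x ∈ affineBlowup.chartι (I := I) b.1 b.2 ''ᵁ ⊤
  rw [affineBlowup.image_top_chartι]
  exact hb

/-- **The exceptional ideal of the affine blowing up is effective Cartier** in the sense of
`IsEffectiveCartier` (`Blowups.lean`) — the effective-Cartier half of
`IsBlowup (affineBlowup.π I) (affineBlowup.idealSheaf I)` (Görtz–Wedhorn Prop. 13.92 / Stacks
0806 for the construction; the universal-property half is not yet formalized).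
[cite: StacksProject, Tag 02OS] -/
theorem affineBlowup.isEffectiveCartier_exceptionalIdeal :
    IsEffectiveCartier (affineBlowup.exceptionalIdeal I) :=
  affineBlowup.exists_nonZeroDivisor_exceptionalIdeal (I := I)

end Literature.AlgebraicGeometry.Resolution

end
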